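import Summits.ResolutionOfSingularities.ResolutionOfSingularities.Theorems.AbsoluteContactScope
import HarnessLib

/-!
# AbsoluteContactHasseRing — decomp-res node «AbsoluteGiraud» (lens-6 g16), tree file 3/7: §3a the
separable-residue HASSE LEMMA IN KERNEL,
ring level (étale coordinates, separable residue extension: a hypersurface of order 3 at a point with separable
residue field and `p ≠ 3` has
smooth maximal contact after the residue extension — the power-series computation).  PROVED.

Content VERBATIM from the decomp-res lens-6 g16 file `HOME/decomp-res-lens-6/g16/AbsoluteGiraud.lean` (sha256
bc25b5879a7322cd; CRITIC-LEDGER row 118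
CLEARED: MAP +1; it SUPERSEDES g15 `AbsoluteContact.lean` cca8a261, rows 110–112, whose §1–§5 are
byte-identical).  HOME = run/shared/lean/pub/decomp-res.
Host: route `MaxContactCut`, aside 31574 `PVPureGame` through the lens-6 chain SatelliteExit (tree
`Theorems/SatelliteExitClasses`) → g12–g14
BoundaryValve / SwitchExclusion / MemberCalculus (HOME, critic rows 87/93/103; not yet in the tree) → the scope
class `AllHug3Off3` (§1 here).

[WRITER NOTE (decomp-res writer g6): the lens file is split into `AbsoluteContactScope` (§0 g12 vocabulary over the
landed `Branch` + §1 the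
scope class and the perfect half) → `AbsoluteContactPrimitives` (§2, landed earlier) →
`AbsoluteContactHasseRing` / `AbsoluteContactHasse` (§3a/§3
the separable-residue Hasse lemma IN KERNEL) → `AbsoluteContactAxes` (§4/§5 the two axes: residue field of the
root point; absolute contact) →
`AbsoluteGiraudKernel` (§6 scheme-level Giraud persistence of absolute contact under one blowing up) →
`AbsoluteGiraudBranch` (§7 `absGiraud3`,
§8 assembly).  The two Theses-cone imports of the lens file (`Theses.MaxContactCut`, `MaxContactCutPurityValve`)
are unused and dropped, so every
file is route-importable; `set_option` lines dropped; nothing else changed.]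
(Sources: Giraud1975; EncinasVillamayor2000 Thm. 4.9; BravoGarciaEscamillaVillamayor2012 Lemma 4.6;
VillamayorU2008ReesDiff §4; CossartPiltant2008 §2; CossartJannsenSaito2020.)
-/

noncomputable section

open CategoryTheory AlgebraicGeometry TopologicalSpace
open Literature.AlgebraicGeometry.Resolution
open Summit.ResolutionOfSingularities.ResolutionOfSingularities.Theorems
open WeakOrderReduction ForcedTowerClasses PurityValveClasses
open SatelliteExitClasses

namespace Summit.ResolutionOfSingularities.ResolutionOfSingularities.Theorems.AbsoluteContactClasses

section HasseSep

open IsLocalRing MvPowerSeries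

universe u v w

/-! ## §3a The separable-residue Hasse lemma IN KERNEL (rev1): ring level (étale coordinates, separable residue
field — the tree's
`exists_isDiffOpLE_adicOrder_eq_one_of_etaleCoordinates` with `PerfectField K` replaced by `Algebra.IsSeparable K
κ`), local-ring level
(Stacks 00TV: regular + separable residue field + essentially of finite type ⇒ formally smooth, from the tree's
`isSmoothAt_of_isRegularLocalRing_of_formallySmooth_residueField`), scheme level (smooth locus + the standard-smooth
étale chart of the tree's
`exists_isDiffOpLE_adicOrder_eq_one_stalk_of_smooth`). -/

section Ring

variable (K : Type u) [Field K] {σ : Type v} [Fintype σ] [DecidableEq σ]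
  {A : Type w} [CommRing A] [Algebra K A] [Algebra (MvPolynomial σ K) A] [IsScalarTower K (MvPolynomial σ K) A]

omit [Fintype σ] in
/-- `coeff_single_C_add_X'`: Auxiliary step of this node's calculus, VERBATIM from the lens file (see the module
docstring); the statement is its type. [folklore] -/
private theorem coeff_single_C_add_X' (a : A) (i j : σ) :
    coeff (Finsupp.single j 1) (MvPowerSeries.C a + MvPowerSeries.X i : MvPowerSeries σ A) =
      if i = j then 1 else 0 := by
  rw [map_add, MvPowerSeries.coeff_C, MvPowerSeries.coeff_X, if_neg (Finsupp.single_ne_zero.mpr one_ne_zero)]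
  simp only [zero_add, Finsupp.single_left_inj one_ne_zero, eq_comm]

/-- `charP_residueField_of_algebra`: Auxiliary step of this node's calculus, VERBATIM from the lens file (see the
module docstring); the statement is its type. [folklore] -/
private theorem charP_residueField_of_algebra (p : ℕ) [CharP K p] (O : Type*) [CommRing O] [IsLocalRing O] [Algebra K O] :
    CharP (ResidueField O) p :=
  charP_of_injective_ringHom (((residue O).comp (algebraMap K O)).injective) p

/-- Linear-part criterion at a closed point of an algebra étale over affine space, the residue field of the point being
SEPARABLE over `K` (the tree's `exists_isDiffOpLE_adicOrder_eq_one_of_etaleCoordinates` with `PerfectField K` replaced by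
`Algebra.IsSeparable K κ(𝔭)`: perfectness was used only for the separability of the minimal polynomials of the
coordinates of
the point). (Sources: VillamayorU2008ReesDiff, §4.1 and Remark 4.3; EGAIV4, §16.8, Thm. 16.11.2 and §17.6.) -/
theorem exists_isDiffOpLE_adicOrder_eq_one_of_etaleCoordinates_of_isSeparable (p : ℕ) [CharP K p]
    [Algebra.FormallySmooth (MvPolynomial σ K) A] [Algebra.FormallyUnramified (MvPolynomial σ K) A]
    [Algebra.FiniteType K A] (𝔭 : Ideal A) [𝔭.IsMaximal] (O : Type*) [CommRing O] [IsLocalRing O] [Algebra A O]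
    [IsLocalization.AtPrime O 𝔭] [Algebra K O] [IsScalarTower K A O] [Algebra.IsSeparable K (ResidueField O)]
    {N : ℕ} {h : O}
    (h1 : h ∈ maximalIdeal O ^ (N + 1)) (h2 : h ∉ maximalIdeal O ^ (N + 2)) (hp : ¬ p ∣ N + 1) :
    ∃ D : O →ₗ[K] O, IsDiffOpLE K N D ∧ adicOrder (D h) = 1 := by
  haveI : CharP (ResidueField O) p := charP_residueField_of_algebra K p O
  -- the coordinates `x_i ∈ A`
  set x : σ → A := fun i => algebraMap (MvPolynomial σ K) A (MvPolynomial.X i) with hx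
  -- (1) Hasse–Schmidt homomorphism on `A` extending the Taylor shift, and on `O`
  obtain ⟨TA, hTA0, hTAR⟩ := exists_hasseSchmidt_of_formallySmooth K A (σ := σ)
  have hTAK : ∀ c : K, TA (algebraMap K A c) = MvPowerSeries.C (algebraMap K A c) := by
    intro c
    have hc : algebraMap K A c = algebraMap (MvPolynomial σ K) A (MvPolynomial.C c) := by
      rw [← MvPolynomial.algebraMap_eq, ← IsScalarTower.algebraMap_apply]
    conv_lhs => rw [hc, hTAR, MvPolynomial.eval₂_C]
    rfl
  have hTAx : ∀ i, TA (x i) = MvPowerSeries.C (x i) + MvPowerSeries.X i := by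
    intro i
    rw [hx]
    simp only [hTAR, MvPolynomial.eval₂_X]
  obtain ⟨T, hT0, hTK, hTA⟩ := exists_hasseSchmidt_localization TA O 𝔭.primeCompl hTA0 hTAK
  have hTcomp : ∀ (β : σ →₀ ℕ) (a : A),
      hsComponent T β (algebraMap A O a) = algebraMap A O (hsComponent TA β a) := by
    intro β a
    simp only [hsComponent, hTA, MvPowerSeries.coeff_map]
  -- (2) the residue field and the separable minimal polynomials of the coordinates of the point
  letI := Ideal.Quotient.field 𝔭
  haveI : Algebra.FiniteType K (A ⧸ 𝔭) :=
    Algebra.FiniteType.of_surjective (Ideal.Quotient.mkₐ K 𝔭) (Ideal.Quotient.mkₐ_surjective K 𝔭)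
  haveI : Module.Finite K (A ⧸ 𝔭) := finite_of_finite_type_of_isJacobsonRing K (A ⧸ 𝔭)
  set a : σ → A ⧸ 𝔭 := fun i => Ideal.Quotient.mk 𝔭 (x i) with ha
  have hint : ∀ i, IsIntegral K (a i) := fun i => Algebra.IsIntegral.isIntegral (a i)
  set π : σ → Polynomial K := fun i => minpoly K (a i) with hπ
  -- `κ(𝔭) = A/𝔭 ↪ κ(O)` as `K`-algebras, so the minimal polynomials are those of elements of the separable `κ(O)`
  have hker : ∀ b ∈ 𝔭, ((IsScalarTower.toAlgHom K O (ResidueField O)).comp (IsScalarTower.toAlgHom K A O)) b = 0 := by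
    intro b hb
    change residue O (algebraMap A O b) = 0
    exact (residue_eq_zero_iff _).mpr ((IsLocalization.AtPrime.to_map_mem_maximal_iff O 𝔭 b).mpr hb)
  set ψ : A ⧸ 𝔭 →ₐ[K] ResidueField O :=
    Ideal.Quotient.liftₐ 𝔭 ((IsScalarTower.toAlgHom K O (ResidueField O)).comp (IsScalarTower.toAlgHom K A O)) hker
    with hψ
  have hψinj : Function.Injective ψ := ψ.toRingHom.injective
  have hπsep : ∀ i, (π i).Separable := by
    intro i
    have hs : (minpoly K (ψ (a i))).Separable := Algebra.IsSeparable.isSeparable K (ψ (a i))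
    rwa [minpoly.algHom_eq ψ hψinj] at hs
  have hπ𝔭 : ∀ i, Polynomial.aeval (x i) (π i) ∈ 𝔭 := by
    intro i
    rw [← Ideal.Quotient.eq_zero_iff_mem, ← Ideal.Quotient.algebraMap_eq, ← Polynomial.aeval_algebraMap_apply,
      Ideal.Quotient.algebraMap_eq]
    exact minpoly.aeval K (a i)
  have hπ'𝔭 : ∀ i, Polynomial.aeval (x i) (Polynomial.derivative (π i)) ∉ 𝔭 := by
    intro i hmem
    apply (hπsep i).aeval_derivative_ne_zero (minpoly.aeval K (a i))
    rw [ha]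
    simp only
    rw [← Ideal.Quotient.algebraMap_eq, Polynomial.aeval_algebraMap_apply, Ideal.Quotient.algebraMap_eq,
      Ideal.Quotient.eq_zero_iff_mem]
    exact hmem
  -- (3) the maximal ideal of `O` is generated by the `w_i = π_i(x_i)`
  have hmax := maximalIdeal_eq_span_aeval_of_formallyUnramified K 𝔭 O π hπsep hπ𝔭
  set w : σ → O := fun i => algebraMap A O (Polynomial.aeval (x i) (π i)) with hw
  have hmax' : maximalIdeal O = Ideal.span (Set.range w) := hmax
  have hw𝔪 : ∀ i, w i ∈ maximalIdeal O := fun i => hmax' ▸ Ideal.subset_span ⟨i, rfl⟩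
  have hv : ∀ i, IsUnit (algebraMap A O (Polynomial.aeval (x i) (Polynomial.derivative (π i)))) := fun i =>
    IsLocalization.map_units O (⟨_, hπ'𝔭 i⟩ : 𝔭.primeCompl)
  set u : σ → O := fun i => w i * ↑(hv i).unit⁻¹ with hu
  have hspan : Ideal.span (Set.range u) = maximalIdeal O := by
    rw [hmax']
    apply le_antisymm
    · rw [Ideal.span_le]
      rintro _ ⟨i, rfl⟩
      exact Ideal.mul_mem_right _ _ (Ideal.subset_span ⟨i, rfl⟩)
    · rw [Ideal.span_le]
      rintro _ ⟨i, rfl⟩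
      have : w i = u i * ↑(hv i).unit := by
        rw [hu]
        simp only
        rw [mul_assoc, Units.inv_mul, mul_one]
      rw [SetLike.mem_coe, this]
      exact Ideal.mul_mem_right _ _ (Ideal.subset_span ⟨i, rfl⟩)
  -- first-order adaptation `D^{[e_j]} u_i ≡ δ_ij (mod 𝔪)`
  have hDw : ∀ i j, hsComponent T (Finsupp.single j 1) (w i) =
      algebraMap A O (Polynomial.aeval (x i) (Polynomial.derivative (π i))) * (if i = j then 1 else 0) := by
    intro i j
    rw [hw]
    simp only
    rw [hTcomp, hsComponent_single_aeval TA hTA0 hTAK, map_mul]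
    congr 1
    rw [hsComponent, hTAx, coeff_single_C_add_X']
    split_ifs <;> simp
  have hlin : ∀ i j, hsComponent T (Finsupp.single j 1) (u i) - (if i = j then 1 else 0) ∈ maximalIdeal O := by
    intro i j
    rw [hu]
    simp only
    rw [hsComponent_single_mul T hT0, hDw]
    have hrest : w i * hsComponent T (Finsupp.single j 1) ↑(hv i).unit⁻¹ ∈ maximalIdeal O :=
      Ideal.mul_mem_right _ _ (hw𝔪 i)
    have hvv : algebraMap A O (Polynomial.aeval (x i) (Polynomial.derivative (π i))) * ↑(hv i).unit⁻¹ = 1 :=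
      (hv i).mul_val_inv
    split_ifs with hij
    · rw [mul_one, hvv, add_sub_cancel_left]
      exact hrest
    · rw [mul_zero, zero_mul, zero_add, sub_zero]
      exact hrest
  -- (4) conclude by the abstract linear-part criterion
  obtain ⟨β, hβ, hord⟩ := exists_hsComponent_adicOrder_eq_one T p hT0 hspan hlin h1 h2 hp
  exact ⟨hsComponentₗ T hTK β, hβ ▸ isDiffOpLE_hsComponentₗ T hTK hT0 (Finsupp.degree β) β le_rfl, hord⟩

end Ring

end HasseSep

end Summit.ResolutionOfSingularities.ResolutionOfSingularities.Theorems.AbsoluteContactClasses
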